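import Mathlib
import Summits.PneNP.PneNP.Theorems.ClusUniversalCertificateLayerDefs

/-!
# Route ClusUniversalCertificate, crux `UniversalCertAll` — line `layer`: the FRACTIONAL layer objects (definitions)

Route-independent definitions file (no `Theses` import) for the fractional path of line `layer` on crux
`Summit.PneNP.PneNP.Theses.ClusUniversalCertificate.UniversalCertAll` (stmt-PneNP-19683, rung F-N1, cell pnp-ideate p1;
skeleton v5 sha16 12a0894d3a91, registered 2026-08-27T08:30Z).  The four statements below are the skeleton's VERBATIM, placed in
the namespace of the defs of record `Summit.PneNP.PneNP.Theorems.ClusLayer` (file `ClusUniversalCertificateLayerDefs`, whose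
`dimSum` / `UCIneq` / `UCLeTwo` they use):

* `IsFracLayerFamily m Y k L` — a list of members `S ⊆ (𝔽₂^m)^n` with nonnegative rational weights `w_S` covering every
  `k`-fibre of `Y ⊆ (𝔽₂^m)^{n+1}` with total weight equal to its multiplicity (`Σ_S w_S 1_S = f`);
* `FracLayerIneq m Y k L` — `D(Y) ≤ Σ_S w_S D(S) + (m−1)|Y| + 2^m Z_k(Y)` in `ℚ`;
* `FracLayerLemmaFrom3` — the (optional, weaker) fractional form of the line's conjecture (XL, OPEN);
* `FracLayerStepAll` — the weighted bookkeeping step;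

and the sorry-free induction `ucIneq_all_frac` (two-block base + fractional lemma + fractional step ⇒ the certificate for all
`n, m`), exactly as in the skeleton.  Nothing here is proved about the conjecture; nothing here bears on P vs NP.
-/

set_option linter.dupNamespace false -- `Summit.PneNP.PneNP.…`: summit = sub-problem name (D-0017 single-conjunct layout)

namespace Summit.PneNP.PneNP.Theorems.ClusLayer

open Finset

/-- FRACTIONAL layer family: members with nonnegative rational weights covering each `k`-fibre with total weight equal to its
multiplicity (an integral layer family = unit weights; a convex combination of colourings is one too). -/
def IsFracLayerFamily {n : ℕ} (m : ℕ) (Y : Finset (Fin (n + 1) → Fin m → ZMod 2)) (k : Fin (n + 1))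
    (L : List (Finset (Fin n → Fin m → ZMod 2) × ℚ)) : Prop :=
  (∀ p ∈ L, 0 ≤ p.2) ∧
    ∀ x : Fin n → Fin m → ZMod 2,
      (L.map fun p => if x ∈ p.1 then p.2 else 0).sum = ((Y.filter fun y => Fin.removeNth k y = x).card : ℚ)

/-- The fractional LAYER INEQUALITY: `D(Y) ≤ Σ w_S·D(S) + (m−1)|Y| + 2^m·#{y ∈ Y : y_k = 0}`. -/
def FracLayerIneq {n : ℕ} (m : ℕ) (Y : Finset (Fin (n + 1) → Fin m → ZMod 2)) (k : Fin (n + 1))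
    (L : List (Finset (Fin n → Fin m → ZMod 2) × ℚ)) : Prop :=
  (dimSum m Y : ℚ) ≤ (L.map fun p => p.2 * (dimSum m p.1 : ℚ)).sum + ((m : ℚ) - 1) * (Y.card : ℚ) +
    (2 : ℚ) ^ m * ((Y.filter fun y => y k = 0).card : ℚ)

/-- CONJECTURE, fractional form (optional weaker stub; `LayerLemmaFrom3` ⟹ this).  LP-dual form: for every potential `π ≥ 0` on
`(𝔽₂^m)^n` DOMINATING `D` (`Σ_{x̄∈S} π(x̄) ≥ D(S)` for all finite `S`), some block `k` has `Σ_{y∈Y} π(π_k y) ≥ D(Y) − (m−1)|Y| − 2^m Z_k(Y)`. -/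
def FracLayerLemmaFrom3 : Prop :=
  ∀ n m : ℕ, 2 ≤ n → ∀ Y : Finset (Fin (n + 1) → Fin m → ZMod 2),
    ∃ k : Fin (n + 1), ∃ L : List (Finset (Fin n → Fin m → ZMod 2) × ℚ), IsFracLayerFamily m Y k L ∧ FracLayerIneq m Y k L

/-- BOOKKEEPING, fractional form: `Σ w_S |S| = |Y|`, `Σ w_S Z_j(S) = Z_{k.succAbove j}(Y)`; weighted member certificates plus the
fractional layer inequality give the certificate of `Y` (same double counting as the landed `ClusLayer.stub_layerStep`, in `ℚ`). -/
def FracLayerStepAll : Prop :=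
  ∀ n m : ℕ, ∀ Y : Finset (Fin (n + 1) → Fin m → ZMod 2), ∀ k : Fin (n + 1),
    ∀ L : List (Finset (Fin n → Fin m → ZMod 2) × ℚ),
      IsFracLayerFamily m Y k L → FracLayerIneq m Y k L → (∀ p ∈ L, UCIneq n m p.1) → UCIneq (n + 1) m Y

/-- Induction on the number of blocks through the fractional path (skeleton v5, verbatim): the two-block base, the fractional
layer lemma from three blocks on, and the fractional step give the certificate for all `n, m`. -/
theorem ucIneq_all_frac (h₀ : UCLeTwo) (h₁ : FracLayerLemmaFrom3) (h₂ : FracLayerStepAll) :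
    ∀ n m : ℕ, ∀ Y : Finset (Fin n → Fin m → ZMod 2), UCIneq n m Y := by
  intro n
  induction n with
  | zero => intro m Y; exact h₀ 0 m (by omega) Y
  | succ n ih =>
    intro m Y
    by_cases hn : 2 ≤ n
    · obtain ⟨k, L, hfam, hineq⟩ := h₁ n m hn Y
      exact h₂ n m Y k L hfam hineq fun p _ => ih m p.1
    · exact h₀ (n + 1) m (by omega) Y

end Summit.PneNP.PneNP.Theorems.ClusLayer
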